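import Summits.AnomalousDissipation.AnomalousDissipation.Theorems.SolenoidalFractalHomogenisationLagrangianCarrierConstructionRegularLWindowDistortion
import Summits.AnomalousDissipation.AnomalousDissipation.Theorems.SolenoidalFractalHomogenisationLagrangianStepFrameDistortion

/-!
# K1L_D (stmt-AnomalousDissipation-27980), glue v2 / L5-0: the exact-flow frame is STRAIN-CLOSE to the identity on a refresh window —
# `|frameG − 1| ≤ C_W · (Σ_{i≤m} a_i)·(t − jR) ≤ C_W · strain m` under the strain-budget ceiling (helper, `--supports 27980 --as helper`)

prover ad-k1loc-p3 g8 (the `hnear` input of `FrameForm.isModulation_frameG_of`, `…LagrangianStepFrameModulation` p695470, with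
`θ := Cα'·E.strain m` as lead-k1l-onelevel-p1 g5's L5-0 spec asks).  The K3L distortion tower
(`…RegularLDistortion.distortion_tower`, stmt-AnomalousDissipation-24913) gives on every refresh window of level `m+1`, under the ceiling
`θ₀ ≤ θs(k, W)`, the STRAIN-EXPLICIT bound `‖DΦ_m(s→t) − I‖ ≤ 1.21·(exp(M·S_m·|t−s|) − 1) + 3.3·L·U·θ₀·S_m·|t−s|` (`S_m = Σ_{i<m} a (i+1)`,
`M = 3√3 k`, `U = k/(2π)`, `L` the level Hessian constant of the design) besides the uniform `≤ 1/10` exported by `…RegularLWindowDistortion`.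
This file exports the strain-explicit form in the `flowDeriv` / `frameG` vocabulary of the K1L frame files:
* `flowDeriv_sub_id_le_strain` — `∃ θs > 0, ∃ C ≥ 0` (depending on `k, W` only): for every `LPermissible`, `Regular` carrier of design `W` with
  `N_m² ≤ N_{m+1}` and the template (T4) at `θ₀ ≤ θs`, on every window `‖flowDeriv m t (jR) y − id‖ ≤ C·S_m·(t − jR)` AND `≤ 1/10`;
* `abs_frameG_sub_one_le_strain` — hence entrywise `|frameG E m t (jR) y i l − δ_il| ≤ 5·C·S_m·(t − jR)` (Neumann series
  `FrameMatrix.abs_inv_sub_one_le` with `3ε ≤ 3/10`), and `S_m·(t − jR) ≤ strain m` (`strain_window_le`).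
No sorry, no definition, no named fact.  NOT a proof of (V_mod), of `stub_cellInputs`, of K1L_D or of AD; rung F-D1.A0.
-/

set_option linter.dupNamespace false

noncomputable section

namespace Summit.AnomalousDissipation.AnomalousDissipation.Theorems.SolenoidalFractalHomogenisation.LagrangianStep.FrameForm

open Set Function Filter
open scoped NNReal
open Literature.Analysis Literature.Analysis.ODE Literature.Analysis.FunctionSpaces Literature.Analysis.FunctionSpaces.Torus
open Literature.Analysis.FluidPDE Literature.Analysis.FluidPDE.LatticeShear
open Summit.AnomalousDissipation.AnomalousDissipation.Theorems.SolenoidalFractalHomogenisation.LagrangianCarrierConstruction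
open Summit.AnomalousDissipation.AnomalousDissipation.Theorems.SolenoidalFractalHomogenisation.LagrangianCarrier

variable {k : ℕ}

/-- `exp x − 1 ≤ 3x` for `0 ≤ x ≤ 1` (`exp x − 1 ≤ x·exp x ≤ e·x`); private: the public name is landed as
`Literature.NumberTheory.Sieve.exp_sub_one_le_three_mul` (gate dedup), not imported into the fluid files. [folklore] -/
private theorem exp_sub_one_le_three_mul {x : ℝ} (hx0 : 0 ≤ x) (hx1 : x ≤ 1) : Real.exp x - 1 ≤ 3 * x := by
  have h1 : Real.exp x - 1 ≤ x * Real.exp x := by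
    have h := Real.add_one_le_exp (-x)
    have hpos := Real.exp_pos x
    have e : Real.exp (-x) * Real.exp x = 1 := by rw [← Real.exp_add]; simp
    nlinarith [mul_le_mul_of_nonneg_right h hpos.le]
  have h2 : Real.exp x ≤ 3 := by
    have := Real.exp_le_exp.mpr hx1
    have h3 : Real.exp 1 < 3 := lt_trans Real.exp_one_lt_d9 (by norm_num)
    linarith
  nlinarith

/-- On one window the accumulated strain of the coarse levels is at most `strain m`: `S_m·(t − jR) ≤ strain m`. [folklore] -/
theorem strain_window_le (E : LagrangianLatticeCarrier k) (m : ℕ) (j : ℤ) {t : ℝ} (ht : t ∈ E.window (m + 1) j) :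
    (∑ i ∈ Finset.range m, E.a (i + 1)) * (t - (j : ℝ) * E.refresh (m + 1)) ≤ E.strain m := by
  have hS : 0 ≤ ∑ i ∈ Finset.range m, E.a (i + 1) := Finset.sum_nonneg fun i _ => (E.toFractalCarrierData.a_pos _).le
  have hlt := abs_sub_lt_refresh_of_mem_window E (m + 1) j (left_mem_window E (m + 1) j) ht
  have h1 : t - (j : ℝ) * E.refresh (m + 1) ≤ E.refresh (m + 1) := (le_abs_self _).trans hlt.le
  exact (mul_le_mul_of_nonneg_left h1 hS).trans (le_of_eq rfl)

/-- **Strain-explicit window distortion of the coarse flow (`flowDeriv` form).**  For every design `W` there are `θs > 0` and `C ≥ 0` such that,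
for every `LPermissible`, `Regular` carrier of design `W` with `N_m² ≤ N_{m+1}` and the template (T4) at `θ₀ ≤ θs`, on every refresh window of
level `m+1` with left end `jR`: `‖flowDeriv m t (jR) y − id‖ ≤ C·(Σ_{i<m} a (i+1))·(t − jR)` and `≤ 1/10`.
[cite: ArmstrongVicol2025, Prop. 2.2 (p. 19) and Cor. 2.4 (p. 22); §5.1] -/
theorem flowDeriv_sub_id_le_strain (k : ℕ) (W : LatticeWord k) : ∃ θs : ℝ, 0 < θs ∧ ∃ C : ℝ, 0 ≤ C ∧
    ∀ (E : LagrangianLatticeCarrier k) (θ₀ : ℝ), E.design = W → θ₀ ≤ θs → E.LPermissible → E.Regular →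
      (∀ m, E.N m ^ 2 ≤ E.N (m + 1)) → (∀ m, E.θ (m + 1) * ((E.N (m + 1) : ℝ) / E.N m) ^ (1 / 16 : ℝ) ≤ θ₀) →
      ∀ (m : ℕ) (j : ℤ), ∀ t ∈ E.window (m + 1) j, ∀ y : UnitAddTorus (Fin 3),
        ‖E.flowDeriv m t ((j : ℝ) * E.refresh (m + 1)) y - ContinuousLinearMap.id ℝ (EuclideanSpace ℝ (Fin 3))‖ ≤
            C * ((∑ i ∈ Finset.range m, E.a (i + 1)) * (t - (j : ℝ) * E.refresh (m + 1))) ∧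
        ‖E.flowDeriv m t ((j : ℝ) * E.refresh (m + 1)) y - ContinuousLinearMap.id ℝ (EuclideanSpace ℝ (Fin 3))‖ ≤ 1 / 10 := by
  obtain ⟨L, hL0, hL2W⟩ := exists_levelHessianConst W
  set M : ℝ := Real.sqrt 3 * (3 * (k : ℝ)) with hM
  set U : ℝ := (k : ℝ) / (2 * Real.pi) with hU
  have hM0 : 0 ≤ M := by positivity
  have hU0 : 0 ≤ U := by positivity
  refine ⟨min 1 (min (1 / (60 * M + 1)) (1 / (66 * (L * U) + 1))), lt_min one_pos (lt_min (by positivity) (by positivity)),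
    121 / 100 * (3 * M) + 33 / 10 * L * U, by positivity, ?_⟩
  intro E θ₀ hD hθs hLP hReg hsq hT4 m j t ht y
  have hP := hLP.permissible
  have hLag := hLP.isLagrangian
  have hLR := hReg.levelRegular
  have hN0 : E.N 0 = 1 := hP.1
  have hN2 : ∀ m, 2 * E.N m ≤ E.N (m + 1) := hP.2.2.1
  have hNpos : ∀ m, (0 : ℝ) < E.N m := fun m => by exact_mod_cast E.toFractalCarrierData.N_pos m
  have hNmono : ∀ m, (E.N m : ℝ) ≤ E.N (m + 1) := fun m => by
    have h : (2 : ℝ) * E.N m ≤ E.N (m + 1) := by exact_mod_cast hN2 m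
    linarith [hNpos m]
  have hθ : ∀ m, E.θ (m + 1) ≤ θ₀ := fun m => by
    have hr : (1 : ℝ) ≤ ((E.N (m + 1) : ℝ) / E.N m) ^ (1 / 16 : ℝ) :=
      Real.one_le_rpow ((one_le_div (hNpos m)).2 (hNmono m)) (by norm_num)
    calc E.θ (m + 1) = E.θ (m + 1) * 1 := (mul_one _).symm
      _ ≤ E.θ (m + 1) * ((E.N (m + 1) : ℝ) / E.N m) ^ (1 / 16 : ℝ) := mul_le_mul_of_nonneg_left hr (E.θ_pos _).le
      _ ≤ θ₀ := hT4 m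
  have hθ0 : 0 < θ₀ := (E.θ_pos 1).trans_le (hθ 0)
  have hθ1 : θ₀ ≤ 1 := hθs.trans (min_le_left _ _)
  have hθM : 60 * (M * θ₀) ≤ 1 := by
    have h : θ₀ ≤ 1 / (60 * M + 1) := hθs.trans ((min_le_right _ _).trans (min_le_left _ _))
    rw [le_div_iff₀ (by positivity)] at h
    nlinarith
  have hθL : 66 * (L * U * θ₀) ≤ 1 := by
    have h : θ₀ ≤ 1 / (66 * (L * U) + 1) := hθs.trans ((min_le_right _ _).trans (min_le_right _ _))
    rw [le_div_iff₀ (by positivity)] at h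
    nlinarith [mul_nonneg hL0 hU0]
  have tower := distortion_tower E θ₀ hLag hLR.continuous_uncurry_b hLR.isSmooth_b hLR.exists_norm_iteratedFDeriv_b_le
    hLR.continuous_disp hLR.isSmooth_disp hLP.refresh_nested hLP.strain_le hθ hN0 hN2 hsq hL0 (hL2W E.toFractalCarrierData hD)
    hθ1 (by rw [hM] at hθM; simpa [mul_assoc] using hθM) (by simpa [hU, mul_assoc] using hθL)
  obtain ⟨h1, h2, -⟩ := tower m j ((j : ℝ) * E.refresh (m + 1)) t (left_mem_window E (m + 1) j) ht
  have e := fderiv_evolutionMap_partialSum E m (hLag m).1 hLR.continuous_uncurry_b hLR.isSmooth_b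
    hLR.exists_norm_iteratedFDeriv_b_le hLR.continuous_disp hLR.isSmooth_disp ((j : ℝ) * E.refresh (m + 1)) t (repr y)
  have h1' := h1 (repr y)
  have h2' := h2 (repr y)
  rw [e, proj_repr] at h1' h2'
  refine ⟨h1'.trans ?_, h2'⟩
  -- bound the tower's right-hand side linearly in `S_m · (t − jR)`
  set S : ℝ := ∑ i ∈ Finset.range m, E.a (i + 1) with hSdef
  have hS0 : 0 ≤ S := Finset.sum_nonneg fun i _ => (E.toFractalCarrierData.a_pos _).le
  have hdt : 0 ≤ t - (j : ℝ) * E.refresh (m + 1) := by linarith [ht.1]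
  have habs : |t - (j : ℝ) * E.refresh (m + 1)| = t - (j : ℝ) * E.refresh (m + 1) := abs_of_nonneg hdt
  rw [habs]
  have hx0 : 0 ≤ M * S * (t - (j : ℝ) * E.refresh (m + 1)) := by positivity
  have hstrain : S * (t - (j : ℝ) * E.refresh (m + 1)) ≤ θ₀ :=
    (strain_window_le E m j ht).trans ((hLP.strain_le m).trans (hθ m))
  have hx1 : M * S * (t - (j : ℝ) * E.refresh (m + 1)) ≤ 1 := by
    have : M * (S * (t - (j : ℝ) * E.refresh (m + 1))) ≤ M * θ₀ := mul_le_mul_of_nonneg_left hstrain hM0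
    nlinarith
  have hexp := exp_sub_one_le_three_mul hx0 hx1
  have hθ01 : θ₀ * (S * (t - (j : ℝ) * E.refresh (m + 1))) ≤ S * (t - (j : ℝ) * E.refresh (m + 1)) := by
    have := mul_le_mul_of_nonneg_right hθ1 (mul_nonneg hS0 hdt)
    linarith
  have hLU : 0 ≤ L * U := mul_nonneg hL0 hU0
  nlinarith [mul_le_mul_of_nonneg_left hexp (by norm_num : (0:ℝ) ≤ 121 / 100),
    mul_le_mul_of_nonneg_left hθ01 (by positivity : (0:ℝ) ≤ 33 / 10 * L * U)]

/-- **Strain-explicit near-identity of the inverse frame (entrywise).**  With the `θs, C` of `flowDeriv_sub_id_le_strain`: on every refresh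
window, `|frameG E m t (jR) y i l − δ_il| ≤ 5·C·(Σ_{i<m} a (i+1))·(t − jR)` (and the right-hand side is `≤ 5·C·strain m` by `strain_window_le`). -/
theorem abs_frameG_sub_one_le_strain (k : ℕ) (W : LatticeWord k) : ∃ θs : ℝ, 0 < θs ∧ ∃ C : ℝ, 0 ≤ C ∧
    ∀ (E : LagrangianLatticeCarrier k) (θ₀ : ℝ), E.design = W → θ₀ ≤ θs → E.LPermissible → E.Regular →
      (∀ m, E.N m ^ 2 ≤ E.N (m + 1)) → (∀ m, E.θ (m + 1) * ((E.N (m + 1) : ℝ) / E.N m) ^ (1 / 16 : ℝ) ≤ θ₀) →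
      ∀ (m : ℕ) (j : ℤ), ∀ t ∈ E.window (m + 1) j, ∀ (y : UnitAddTorus (Fin 3)) (i l : Fin 3),
        |frameG E m t ((j : ℝ) * E.refresh (m + 1)) y i l - (1 : Matrix (Fin 3) (Fin 3) ℝ) i l| ≤
          5 * C * ((∑ i ∈ Finset.range m, E.a (i + 1)) * (t - (j : ℝ) * E.refresh (m + 1))) := by
  obtain ⟨θs, hθs, C, hC, H⟩ := flowDeriv_sub_id_le_strain k W
  refine ⟨θs, hθs, C, hC, fun E θ₀ hD hθ hLP hReg hsq hT4 m j t ht y i l => ?_⟩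
  obtain ⟨hlin, htenth⟩ := H E θ₀ hD hθ hLP hReg hsq hT4 m j t ht y
  set ε : ℝ := ‖E.flowDeriv m t ((j : ℝ) * E.refresh (m + 1)) y - ContinuousLinearMap.id ℝ (EuclideanSpace ℝ (Fin 3))‖ with hε
  have hε0 : 0 ≤ ε := norm_nonneg _
  have hentry : ∀ a c : Fin 3, |frameJac E m t ((j : ℝ) * E.refresh (m + 1)) y a c - (1 : Matrix (Fin 3) (Fin 3) ℝ) a c| ≤ ε := by
    intro a c
    rw [frameJac, Matrix.of_apply, Matrix.one_apply]
    exact abs_apply_single_sub_le_opNorm (E.flowDeriv m t ((j : ℝ) * E.refresh (m + 1)) y) a c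
  have hcard : (Fintype.card (Fin 3) : ℝ) * ε < 1 := by
    simp only [Fintype.card_fin, Nat.cast_ofNat]; linarith
  have h := abs_inv_sub_one_le (frameJac E m t ((j : ℝ) * E.refresh (m + 1)) y) hε0 hcard hentry i l
  rw [frameG]
  refine h.trans ?_
  simp only [Fintype.card_fin, Nat.cast_ofNat]
  -- 3ε/(1 − 3ε) ≤ 5ε ≤ 5·C·S·(t − jR)   (since 3ε ≤ 3/10)
  have hden : (7 : ℝ) / 10 ≤ 1 - 3 * ε := by linarith
  have hle : 3 * ε / (1 - 3 * ε) ≤ 5 * ε := by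
    rw [div_le_iff₀ (by linarith)]
    nlinarith
  exact hle.trans (by nlinarith)

end Summit.AnomalousDissipation.AnomalousDissipation.Theorems.SolenoidalFractalHomogenisation.LagrangianStep.FrameForm

end
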